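import Literature.MathematicalPhysics.QuantumFieldTheory.Balaban1983to89.B8Ineq145
import Literature.MathematicalPhysics.QuantumFieldTheory.Balaban1983to89.B7BlockAvgLog

/-!
# `Balaban1983to89.B8Ineq145Flat` — the flat abelian dictionary of `B8Ineq145` §5, kernel-computed

Sibling of `Balaban1983to89.B8Ineq145` (census row C-B8-30, gap G-adv8-16, cross-read XREAD #92 (c)).  That module
left ONE step as a hand computation («Dictionary … not formalised here», its §5 and «What is NOT claimed»):
that on the flat abelian configuration `U₀ ≡ 1`, `U₁ ≡ e^{iηaX}` the averaging operations of B7 give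
`\bar\bar U₁^n = e^{iL^nηaX}`, block factor `exp(i·(d(L−1)/2)·L^{j}ηa·X)`, hence on a bond crossing into the
next level `|Ũ′_b − 1| = 2|sin(flatRatio d L · L^{j+1}ηa / 2)|`.  This module builds an explicit lattice model of
the printed formulas of B7 for an ABELIAN structure group (`G = U(1)`, admissible: B7 p. 18 «with values in a Lie
subgroup `G` of a unitary group `U(N)`»; equivalently all variables in one maximal torus) and makes every line
of that dictionary a kernel-checked evaluation, ending in the numerical refutation of the printed constant of
B8 (1.145) on crossing bonds for `d = 4`, `L = 3` and ALL `0 < α₂ ≤ 1/4`.  A second, independent engine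
(plain-Python complex and `SU(2)`-matrix arithmetic on actual staircase words; census attachment
`b2b-balaban-b08/flat_b7_check.py` + `.out`) reproduces every phase below to `≤ 4.2e-16` for
`(d, L) ∈ {2,3,4} × {2,3}` and the final table.  Value = kernel certificate + numerics for a located objection;
NOT progress on the summit `Summit.QuantumFields`.  Nothing here is cited as a fact: every `theorem` is
kernel-proved, every `def` transcribes a displayed formula whose text and page are quoted next to it.

## Sources (pages verified on the page images; B5 = Bałaban, CMP 95 (1984) 17–40 `Balaban1984PropagatorsI`;
B7 = CMP 98 (1985) 17–51 `Balaban1985Averaging`; B8 = CMP 99 (1985) 75–102 `Balaban1985RegularSpaces`)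

* B5 p. 18: «We assume that `A_b` is defined for bonds `b` with arbitrary orientation and that
  `A_{⟨x,x′⟩} = −A_{⟨x′,x⟩}`.»  (1.6) `B(y) = {x ∈ T₁ : y_μ ≤ x_μ < y_μ + L, μ = 1, …, d}, y ∈ T_L^{(1)}`.
  (1.7) `Γ_{y,x} = [y,(y₁,…,y_{d−1},x_d)] ∪ … ∪ [(y₁,…,y_μ,x_{μ+1},…,x_d),(y₁,…,x_μ,x_{μ+1},…,x_d)] ∪ … ∪
  [(y₁,x₂,…,x_d),x]`, «We consider `Γ_{y,x}`, and all other contours appearing in the paper, as oriented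
  contours, with initial point `y` and final point `x`.»  B5 p. 19 (1.8): `… A(Γ_{c₋,x}) + A([x, x(c)]) +
  A(Γ_{x(c),c₊}) …`, «`A(Γ) = Σ_{b⊂Γ} A_b` for arbitrary contour `Γ`», `x(c) = x + Le_μ` for `c = ⟨y, y + Le_μ⟩`.
* B7 p. 17 (2): `B^j(y) = {x ∈ L^{-j}L^nηZ^d : y_μ ≤ x_μ < y_μ + L^nη, μ = 1, …, d}` (lower-corner blocks).
  B7 p. 18 (7) `U(x,x′) = U^{-1}(x′,x)`, (9) `U(Γ) = Π_{i=0}^{n−1} U(x_i, x_{i+1})` «where the order of factors in the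
  product is the same as the order of bonds in `Γ`».  B7 p. 19 (15): `Ū_c = exp[i Σ_{x∈B(c₋)} L^{-d} (1/i)
  log U(Γ_{c,x})U(c)^{-1}] U(c)`, where «`Γ_{c₋,x} ∪ [x, x(c)] ∪ Γ_{x(c),c₊}` is an oriented contour with `c₋` as an
  initial point and `c₊` as a final point.  We denote it by `Γ_{c,x}`».  B7 p. 21 (21): `log X = Σ_{n≥1}
  ((−1)^{n+1}/n)(X − 1)^n` for `|X − 1| < 1`; (23) `log U = i Σ λ_j P_j = iA`, `λ_j ∈ ]−π, π]`; (24) `|U − 1| =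
  max_j |e^{iλ_j} − 1|`.  B7 p. 27 (56) `R(X)Y = XYX^{-1}`; (58) `(R_{0,y}V′)(Γ_{y,x}) = Π_{b⊂Γ_{y,x}} R(V₀(Γ_{y,b₋}))V′_b`.
  B7 p. 30 (78) `(R̄₀v)(y) = v(y) exp[i Σ_{x∈B(y)} L^{-d} (1/i) log v^{-1}(y)R(V₀(Γ_{y,x}))v(x)]`, (82) `(R̄₀u)(x₁) =
  u(x₁)\overline{R_{0,x₁}U₁}`.  B7 p. 31 (87) `u(y) = (\overline{R_{0,y}U₁}^{(k)})^{-1}`; (89) `(\overline{R(V₀)V₁})_c =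
  (\overline{R_{0,c₋}V₁})^{-1}(V₁V₀)‾_c(V̄₀)_c^{-1}R̄_{0,c}\overline{R_{0,c₊}V₁} = (\overline{R_{0,c₋}V₁})^{-1}Ṽ₁R̄_{0,c}
  \overline{R_{0,c₊}V₁}`; (90) `\bar\bar U₁ = \overline{R(U₀)U₁}`; (91) `\bar\bar U₁^{j+1} = \overline{R(Ū₀^j)\bar\bar U₁^j}`.
  B7 p. 32 (97) `(Ũ₁^j)_b = v_j(b₋)(\bar\bar U₁^j)_b R̄^j_{0,b} v_j^{-1}(b₊)`, `v_j(x) = (\overline{R_{0,x}U₁})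
  (\overline{R̄_{0,x}\bar\bar U₁})⋯(\overline{R̄^{j-1}_{0,x}\bar\bar U₁^{j-1}})`; (99) `\overline{R_{0,x}U₁}^{(j)} = v_j(x)`;
  (100) `… = v_j(y)(\overline{R̄^j_{0,y}\bar\bar U₁^j}) = v_{j+1}(y)`.  B7 p. 33 (105) `(\overline{R̄^j_{0,x_{j+1}}
  \bar\bar U₁^j}) = exp[i Σ_{x∈B(x_{j+1})} L^{-d} (1/i) log(R̄^j_{0,x_{j+1}}\bar\bar U₁^j)(Γ_{x_{j+1},x})]`.
* B8 p. 81 (1.29) `(R₀u^j)‾(y) = 1 for y ∈ Λ_j, j = 0, 1, …, k`; (1.30) `(Ũ₁^{u j})_b = u(b₋)(Ũ₁^j)_b R̄^j_{0,b}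
  u^{-1}(b₊) = V_b(Ū₀^j)_b^{-1}, b ∈ Λ_j`; «If a bond `b` crosses the boundary of `Λ_j`, then one of the
  end-points belongs to `Λ_j`, e.g. `b₊ ∈ Λ_j`, and another to `Λ_{j−1}`, `b₋ ∈ Λ_{j−1}`.  In this case the
  formulas (97), (99), and (87) of [3] imply `(Ũ₁^{u j})_b = \overline{R̄^{j−1}_{0,b₋}\bar\bar U₁^{j−1}}(Ū₁^j)_b`
  …, where by the formula (105) of [3] `\overline{R̄^{j−1}_{0,b₋}\bar\bar U₁^{j−1}} = exp[i Σ_{x∈B(b₋)} L^{-d} (1/i)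
  log(R̄^{j−1}_{0,b₋}\bar\bar U₁^{j−1})(Γ_{b₋,x})]`.»  B8 p. 100 (1.140) `L^jη|A|, (L^jη)²|∇^η_{U₀}A|,
  (L^jη)³|D^{η*}_{U₀}D^η_{U₀}A| < α₂ on Ω_j`; «We consider the configuration `U₁U₀`, `U₁ = e^{iηA}`»; Prop. 7
  «… then for `α₀, α₂` sufficiently small we have» (1.145) `|\overline{(U′U₀)}^j − Ū₀^j| = |exp iQ_j(U₀, ηA) − 1|
  < 2α₂ on Ω_j^{(j)}`.

## The model (what is transcribed, and the recorded divergences)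

Sites of every lattice are `ℤ^d` in that lattice's own units (`Site d`); the coarse site `y` has fine
coordinates `Ly` (`base`), its block is `{Ly + o : o ∈ {0,…,L−1}^d}` (B5 (1.6) = B7 (2)); contours are WORDS of
oriented unit steps (`Word d`): the staircase (1.7) `stairWord`, the straight piece `[x, x(c)]` of (1.8)
`straightWord`, and `Γ_{c,x}` of B7 p. 19 `gammaWord`, in which the last piece `Γ_{x(c),c₊}` (initial point
`x(c)`, final point `c₊`; (1.7) defines staircases out of block corners only) is read as `Γ_{c₊,x(c)}^{-1}` —
DIVERGENCE (i); for the flat field it is immaterial: transports depend on the endpoints only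
(`transport_flat`, `netCount_eq_displacement`).  A bond field is `A : Site d → Fin d → 𝕜` = its values on the
positively oriented bonds `⟨x, x + e_μ⟩`, extended to reversed bonds by B5 p. 18 / B7 (7).

§3 (additive form, `𝕜 = ℝ`): for COMMUTING variables `U = e^{iA}` each of B7's `exp[i Σ L^{-d}(1/i) log(…)]`
is the exponential of the mean phase, so (15), (105), (89), (90)–(91), (97)/(100) become the phase maps
`avg15`, `blockF`, `op89`, `level`, `vPhase` — DIVERGENCE (ii): this additive bookkeeping is ours; §4 proves it
IS the value of the printed group-valued formulas for `G = U(1)`.  With `U₀ = V₀ = 1` every `R(V₀(Γ))`,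
`R̄^j_{0,·} = R(Ū₀^j(·))` is `R(1) =` identity and `Ṽ₁ = (V₁V₀)‾(V̄₀)^{-1} = V̄₁` — DIVERGENCE (iii): the
operations `R` are therefore not modelled inside the transports (only the outer `R̄_{0,c}` of (89), as `rC 1`).

§4 (`G = U(1) ⊂ ℂ`, `𝔄 = ℂ`): `gtransport` is (9) with (7); `gavg15`, `gblockF`, `gop89`, `glevel`, `gv` are
(15), (105), (89), (90)–(91), (97)/(100) LITERALLY, the bar being the tree's carrier `B7BlockAvgLog.barAvg`
(`= exp(i Σ wt·(1/i)·mlog(…))`) whose `log` is the series (21) (`MatrixLog.mlog`).  DIVERGENCE (iv): B7 uses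
for unitaries the spectral branch (23) (`λ ∈ ]−π, π]`), which agrees with (21) where the series converges; the
tree's inversion lemma `B7BlockAvgLog.mlog_exp` is stated for `‖C‖ < ln 2`, so the tower is evaluated under
`d(L−1)L^m|θ| < ln 2` for the levels used — for the final numbers (`d = 4`, `L = 3`, `L^{j+1}θ = (27/28)α₂`)
this is `α₂ < 0.2695…`, and the theorems take `0 < α₂ ≤ 1/4`; Prop. 7 is asserted «for `α₀, α₂` sufficiently
small», so this is the relevant range (the second engine, using (23), covers `α₂ ≤ 0.7` as in
`B8Ineq145.flat_witness_exceeds`).  Level indexing: `level`/`glevel n` = `\bar\bar U₁^n` (`n`-lattice units,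
`\bar\bar U₁^0 = U₁`); the crossing bond sits at level `j+1` with its block factor taken from level `j`
(B8 p. 81 with `j ↦ j+1`; B8 writes `Ū₁^j` for B7's `\bar\bar U₁^j`, cf. `B8Ineq145` header).

§5: the level-`(j+1)` data are packaged as an instance `flatLevelData` of gen 9's abstract carrier
`B8Ineq145.LevelData` (`G = ℂˣ`; fields = the displayed laws (1.30), (97), (84)+(99), (100)), with (1.29) imposed
at `b₋ = x₀` at level `j` and at the other sites at level `j+1` — exactly the two instances of (1.29) that B8
p. 81 invokes for a crossing bond; DIVERGENCE (v): B8's gauge transformation `u` is NOT solved from B7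
(64)–(67) on actual domains `Λ_j` here (as in `B8Ineq145`, only its two displayed consequences are used), and no
geometry of the domains `Ω_j ⊃ Λ_j` is modelled (crossing bonds exist in every direction:
`B8ConstraintBonds.exists_classII_printed`).

## What is kernel-proved (all `sorry`-free; `[folklore]` = elementary, proved here)

`transport_flat` (flat transport = `θ ×` signed length), `netCount_stairWord`/`_gammaWord` (staircase to `Ly+o`
has `Σ_μ o_μ` steps; `Γ_{c,x}` has signed length `L`), `avg15_flat: Ū = Lθ` [(15): both logarithm arguments are
`1`], `blockF_flat: F = stairMean d L · θ` (`= d(L−1)/2 · θ`, `B8Ineq145.stairMean_eq`), `op89_flat`,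
`level_flat: \bar\bar U₁^n = L^nθ`, `vPhase_flat`, `crossPhase_flat: F_j + \bar\bar U₁^{j+1} = flatRatio d L ·
L^{j+1}θ` (`B8Ineq145.flat_log_identity`); then for `G = U(1)`: `gtransport_expField` ((9) of `e^{iA}` =
`e^{iA(Γ)}`), `barAvg_exp_phases` (the bar of commuting `e^{iφ_x}`, `|φ_x| < ln 2`, is `e^{i·mean φ}` — via
`barAvg_eq_exp_sum`, `mlog_exp`), `gavg15_expField`, `gblockF_expField`, `gop89_expField_flat` ((89) maps the flat
`e^{iθ}` to the flat `e^{iLθ}`), `glevel_expField_flat` (THE TOWER `\bar\bar U₁^n = e^{iL^nθ}`),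
`gblockF_glevel_flat` (block factor `e^{i(d(L−1)/2)L^jθ}`), `gv_flat`, `gcross_eq` (crossing value
`e^{i·flatRatio·L^{j+1}θ}`), `norm_gcross_sub_one` (`= 2|sin(·/2)|`, Mathlib `Complex.norm_exp_I_mul_ofReal_sub_one`
= B7 (24) for `N = 1`), `flat_tower_violates_145` (`d = 4, L = 3`, `3^{j+1}θ = (27/28)α₂`, `0 < α₂ ≤ 1/4`:
`2α₂ < |Ũ′ − 1|`), and through the `LevelData` instance: `flatLevelData_dictionary` (its fields ARE the tower's
values), `flatLevelData_Uu` (the left-hand side of (1.30) evaluates, by `LevelData.crossing`, to the crossing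
value), `printed_145_fails_on_tower` (`2α₂ < |u(b₋)(Ũ₁^{j+1})_b R̄ u^{-1}(b₊) − 1|`).

## What is NOT claimed

No non-abelian configuration is evaluated (for non-commuting variables the bars are not exponentials of mean
logarithms; the census's `SU(2)` check is numerical only, on a torus, where it reduces to the present one); no
statement about which bonds (1.145) ranges over beyond what `B8Ineq145` adjudicated (this module supplies the
numbers its §5 used, on the configuration its census row names); the typed printed statements of other modules
are untouched; nothing here is progress on `Summit.QuantumFields`.
-/

open scoped BigOperators
open Finset

namespace Literature.MathematicalPhysics.QuantumFieldTheory.Balaban1983to89.B8Ineq145Flat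

open B8Ineq145 B7BlockAvgLog MatrixLog

variable {d : ℕ}

/-! ## §1  Words on `ℤ^d` and additive (abelian, Lie-algebra valued) transport -/

/-- Sites of a lattice `ℤ^d` (every level in its own units). [folklore] -/
abbrev Site (d : ℕ) := Fin d → ℤ

/-- Lattice words: a step `(μ, true)` is the positively oriented bond `⟨x, x + e_μ⟩`, a step `(μ, false)` the
bond `⟨x, x − e_μ⟩` (the inverse of the positive bond `⟨x − e_μ, x⟩`). [folklore] -/
abbrev Word (d : ℕ) := List (Fin d × Bool)

/-- The unit vector `e_μ`. [folklore] -/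
def unitVec (μ : Fin d) : Site d := Pi.single μ 1

/-- Final point of the oriented contour with initial point `x` described by the word `w`. [folklore] -/
def endpoint : Site d → Word d → Site d
  | x, [] => x
  | x, (μ, true) :: w => endpoint (x + unitVec μ) w
  | x, (μ, false) :: w => endpoint (x - unitVec μ) w

/-- B5 (1.8) «`A(Γ) = Σ_{b⊂Γ} A_b` for arbitrary contour `Γ`» with B5 p. 18 «`A_{⟨x,x'⟩} = −A_{⟨x',x⟩}`»: the
additive transport of a bond field `A` (`A x μ` = its value on the positive bond `⟨x, x + e_μ⟩`) along the word
`w` read from the initial point `x`. [cite: Balaban1984PropagatorsI, (1.8) p. 19] -/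
def transport (A : Site d → Fin d → ℝ) : Site d → Word d → ℝ
  | _, [] => 0
  | x, (μ, true) :: w => A x μ + transport A (x + unitVec μ) w
  | x, (μ, false) :: w => -A (x - unitVec μ) μ + transport A (x - unitVec μ) w

/-- `+1` for a positive step, `−1` for a negative one. [folklore] -/
def stepSign (p : Fin d × Bool) : ℤ := if p.2 then 1 else -1

/-- Signed number of steps of a word. [folklore] -/
def netCount (w : Word d) : ℤ := (w.map stepSign).sum

/-- [folklore] -/
theorem netCount_nil : netCount ([] : Word d) = 0 := rfl

/-- [folklore] -/
theorem netCount_cons (p : Fin d × Bool) (w : Word d) : netCount (p :: w) = stepSign p + netCount w := by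
  simp [netCount]

/-- [folklore] -/
theorem netCount_append (w₁ w₂ : Word d) : netCount (w₁ ++ w₂) = netCount w₁ + netCount w₂ := by
  simp [netCount]

/-- The FLAT field: the same value `θ` (`= ηa`, the coefficient of the fixed Cartan element `X`) on every
positively oriented bond. [folklore] -/
def flat (d : ℕ) (θ : ℝ) : Site d → Fin d → ℝ := fun _ _ => θ

/-- Transport of the flat field along any word is `θ ×` its signed step count. [folklore] -/
theorem transport_flat (θ : ℝ) (x : Site d) (w : Word d) :
    transport (flat d θ) x w = θ * netCount w := by
  induction w generalizing x with
  | nil => simp [transport, netCount]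
  | cons p w ih =>
    obtain ⟨μ, b⟩ := p
    cases b
    · simp only [transport, flat, ih, netCount_cons, stepSign, Bool.false_eq_true, ↓reduceIte, Int.cast_add,
        Int.cast_neg, Int.cast_one]
      ring
    · simp only [transport, flat, ih, netCount_cons, stepSign, ↓reduceIte, Int.cast_add, Int.cast_one]
      ring

/-- The signed step count is the total coordinate displacement `Σ_μ (final − initial)_μ`; with `transport_flat`:
the flat transport depends on the contour only through its endpoints (contour shapes are irrelevant below).
[folklore] -/
theorem netCount_eq_displacement (x : Site d) (w : Word d) :
    netCount w = ∑ μ, (endpoint x w μ - x μ) := by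
  induction w generalizing x with
  | nil => simp [endpoint, netCount]
  | cons p w ih =>
    obtain ⟨μ, b⟩ := p
    have hs : ∑ ν, (unitVec μ : Site d) ν = 1 := by
      simp [unitVec, Finset.sum_pi_single']
    cases b
    · rw [netCount_cons, ih (x - unitVec μ)]
      simp only [stepSign, endpoint, Bool.false_eq_true, ↓reduceIte, Pi.sub_apply]
      have : ∑ ν, (endpoint (x - unitVec μ) w ν - (x ν - (unitVec μ : Site d) ν))
          = ∑ ν, (endpoint (x - unitVec μ) w ν - x ν) + ∑ ν, (unitVec μ : Site d) ν := by
        rw [← Finset.sum_add_distrib]; exact Finset.sum_congr rfl fun ν _ => by ring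
      rw [this, hs]; ring
    · rw [netCount_cons, ih (x + unitVec μ)]
      simp only [stepSign, endpoint, ↓reduceIte, Pi.add_apply]
      have : ∑ ν, (endpoint (x + unitVec μ) w ν - (x ν + (unitVec μ : Site d) ν))
          = ∑ ν, (endpoint (x + unitVec μ) w ν - x ν) - ∑ ν, (unitVec μ : Site d) ν := by
        rw [← Finset.sum_sub_distrib]; exact Finset.sum_congr rfl fun ν _ => by ring
      rw [this, hs]; ring

/-! ## §2  The printed geometry: blocks (B5 (1.6)), staircases (B5 (1.7)), `x(c)` (B5 (1.8)), `Γ_{c,x}` (B7 p. 19) -/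

variable (L : ℕ)

/-- B5 (1.7): the staircase contour `Γ_{y,x}` from the block corner `y` to `x = y + o ∈ B(y)` — «initial point
`y` and final point `x`», changing coordinate `d` first, …, coordinate `1` last (`0`-based: `d−1, …, 0`); as a
word it does not depend on `y`. [cite: Balaban1984PropagatorsI, (1.7) p. 18] -/
def stairWord (o : Fin d → Fin L) : Word d :=
  (List.finRange d).reverse.flatMap fun μ => List.replicate (o μ : ℕ) (μ, true)

/-- B5 (1.8): the straight contour `[x, x(c)]`, `x(c) = x + Le_μ` (`L` positive steps in direction `μ`); the
coarse bond `c = ⟨y, y + Le_μ⟩` itself, read on the fine lattice, is the same word from `c₋`.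
[cite: Balaban1984PropagatorsI, (1.8) p. 19] -/
def straightWord (μ : Fin d) : Word d := List.replicate L (μ, true)

/-- The inverse contour `Γ^{-1}` (reversed, orientations flipped). [folklore] -/
def invWord (w : Word d) : Word d := (w.map fun p => (p.1, !p.2)).reverse

/-- B7 p. 19: «`Γ_{c₋,x} ∪ [x, x(c)] ∪ Γ_{x(c),c₊}` is an oriented contour with `c₋` as an initial point and `c₊`
as a final point.  We denote it by `Γ_{c,x}`.»  Here `Γ_{x(c),c₊}` is read as `Γ_{c₊,x(c)}^{-1}` (the staircase
of the block `B(c₊)` reversed); for the flat field any contour from `x(c)` to `c₊` gives the same transport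
(`netCount_eq_displacement`). [cite: Balaban1985Averaging, p. 19 before (15)] -/
def gammaWord (o : Fin d → Fin L) (μ : Fin d) : Word d :=
  stairWord L o ++ straightWord L μ ++ invWord (stairWord L o)

/-- [folklore] -/
theorem netCount_replicate_true (n : ℕ) (μ : Fin d) : netCount (List.replicate n (μ, true)) = n := by
  induction n with
  | zero => simp [netCount]
  | succ n ih =>
    rw [List.replicate_succ, netCount_cons, ih]
    simp only [stepSign, ↓reduceIte]
    push_cast
    ring

/-- [folklore] -/
theorem netCount_flatMap {ι : Type*} (l : List ι) (f : ι → Word d) :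
    netCount (l.flatMap f) = (l.map fun i => netCount (f i)).sum := by
  induction l with
  | nil => simp [netCount]
  | cons i l ih => rw [List.flatMap_cons, netCount_append, ih, List.map_cons, List.sum_cons]

/-- A staircase to `x = y + o` has `Σ_μ o_μ` (positive) steps. [folklore] -/
theorem netCount_stairWord (o : Fin d → Fin L) : netCount (stairWord L o) = ∑ μ, ((o μ : ℕ) : ℤ) := by
  rw [stairWord, netCount_flatMap]
  simp only [netCount_replicate_true]
  rw [List.map_reverse, List.sum_reverse, Fin.sum_univ_def]

/-- [folklore] -/
theorem netCount_invWord (w : Word d) : netCount (invWord w) = -netCount w := by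
  induction w with
  | nil => simp [invWord, netCount]
  | cons p w ih =>
    have h : invWord (p :: w) = invWord w ++ [(p.1, !p.2)] := by simp [invWord]
    rw [h, netCount_append, ih, netCount_cons, netCount_cons, netCount_nil]
    obtain ⟨μ, b⟩ := p
    cases b <;> simp [stepSign]

/-- [folklore] -/
theorem netCount_straightWord (μ : Fin d) : netCount (straightWord L μ) = L :=
  netCount_replicate_true L μ

/-- `Γ_{c,x}` has signed length `L`: the two staircases cancel. [folklore] -/
theorem netCount_gammaWord (o : Fin d → Fin L) (μ : Fin d) : netCount (gammaWord L o μ) = L := by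
  rw [gammaWord, netCount_append, netCount_append, netCount_invWord, netCount_straightWord]
  ring

/-- Fine-lattice coordinates of the coarse site `y` (block corner, B5 (1.6): `B(y) = {x : y_μ ≤ x_μ < y_μ + L}`,
block points `Ly + o`, `o ∈ {0,…,L−1}^d`, in fine units). [cite: Balaban1984PropagatorsI, (1.6) p. 18] -/
def base (y : Site d) : Site d := fun μ => (L : ℤ) * y μ

/-- The weight `L^{-d}` of B7 (15), (78), (105). [cite: Balaban1985Averaging, (15) p. 19] -/
noncomputable def wt (d L : ℕ) : ℝ := ((L : ℝ) ^ d)⁻¹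

/-! ## §3  B7's averaging formulas for an ABELIAN field, additive form, and their flat values

For commuting variables `U = e^{iA}` every `exp[i Σ L^{-d} (1/i) log(…)]` of B7 is the exponential of the
arithmetic mean of the phases (made precise in §4 for `G = U(1)`); this section is that phase bookkeeping. -/

/-- B7 (15) in phases: `(1/i) log Ū_c = Σ_{x∈B(c₋)} L^{-d} [A(Γ_{c,x}) − A(c)] + A(c)` for the coarse bond
`c = ⟨y, y + e_μ⟩` (coarse units), `c₋ = Ly` in fine units. [cite: Balaban1985Averaging, (15) p. 19] -/
noncomputable def avg15 (A : Site d → Fin d → ℝ) (y : Site d) (μ : Fin d) : ℝ :=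
  (∑ o : Fin d → Fin L, wt d L * (transport A (base L y) (gammaWord L o μ)
      - transport A (base L y) (straightWord L μ))) + transport A (base L y) (straightWord L μ)

/-- B7 (78)/(82)/(105) in phases, with `R(V₀(Γ_{y,·})) = R(1) =` identity: the block factor
`(1/i) log \overline{R_{0,y}V} = Σ_{x∈B(y)} L^{-d} A(Γ_{y,x})`. [cite: Balaban1985Averaging, (105) p. 33] -/
noncomputable def blockF (A : Site d → Fin d → ℝ) (y : Site d) : ℝ :=
  ∑ o : Fin d → Fin L, wt d L * transport A (base L y) (stairWord L o)

/-- B7 (89) in phases, with `V₀ = 1` (`Ṽ₁ = V̄₁`, `R̄_{0,c} =` identity):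
`(1/i) log \bar\bar V_c = −F(c₋) + (1/i) log V̄_c + F(c₊)`. [cite: Balaban1985Averaging, (89) p. 31] -/
noncomputable def op89 (A : Site d → Fin d → ℝ) : Site d → Fin d → ℝ :=
  fun y μ => -blockF L A y + avg15 L A y μ + blockF L A (y + unitVec μ)

/-- B7 (90)/(91): the tower `\bar\bar U₁^n`, `n = 0, 1, 2, …` (`\bar\bar U₁^0 := U₁`), each level in its own
units. [cite: Balaban1985Averaging, (90)–(91) p. 31] -/
noncomputable def level (A : Site d → Fin d → ℝ) (n : ℕ) : Site d → Fin d → ℝ := (op89 L)^[n] A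

/-- [folklore] -/
theorem level_zero (A : Site d → Fin d → ℝ) : level L A 0 = A := rfl

/-- [folklore] -/
theorem level_succ (A : Site d → Fin d → ℝ) (n : ℕ) : level L A (n + 1) = op89 L (level L A n) := by
  rw [level, Function.iterate_succ_apply']; rfl

/-- B7 (97)/(100) in phases: `v_0 := 1`, `v_{j+1}(y) = v_j(y)·\overline{R̄^j_{0,y}\bar\bar U₁^j}` (the site
`y ∈ Ω^{(j+1)}` is `Ly` in level-`j` units). [cite: Balaban1985Averaging, (97), (100) p. 32] -/
noncomputable def vPhase (A : Site d → Fin d → ℝ) : ℕ → Site d → ℝ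
  | 0, _ => 0
  | j + 1, y => vPhase A j (base L y) + blockF L (level L A j) y

/-- The phase of `Ũ′^{j+1}_b = F(b₋)·(Ū₁^{j+1})_b` on a bond `b = ⟨x, x + e_μ⟩` crossing into `Λ_{j+1}`
(B8 (1.31) line 2 = `B8Ineq145.LevelData.crossing`): block factor of level `j` at `b₋` plus the level-`(j+1)`
bond phase. [cite: Balaban1985RegularSpaces, (1.31) p. 82] -/
noncomputable def crossPhase (A : Site d → Fin d → ℝ) (j : ℕ) (x : Site d) (μ : Fin d) : ℝ :=
  blockF L (level L A j) x + level L A (j + 1) x μ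

/-- (15) on the flat field: `Ū = e^{iLθ}` — the two staircases of `Γ_{c,x}` cancel against each other and
`[x, x(c)]` against `U(c)^{-1}`, so every logarithm in (15) vanishes. [folklore] -/
theorem avg15_flat (θ : ℝ) (y : Site d) (μ : Fin d) : avg15 L (flat d θ) y μ = L * θ := by
  simp [avg15, transport_flat, netCount_gammaWord, netCount_straightWord]
  ring

/-- (105) on the flat field: the block factor phase is `θ ×` the mean staircase length `stairMean d L`
(`= d(L−1)/2`, `B8Ineq145.stairMean_eq`). [folklore] -/
theorem blockF_flat (θ : ℝ) (y : Site d) : blockF L (flat d θ) y = stairMean d L * θ := by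
  unfold blockF stairMean wt
  simp only [transport_flat, netCount_stairWord]
  push_cast
  simp only [← Finset.mul_sum]
  ring

/-- (89)–(91) on the flat field: one averaging step multiplies the bond phase by `L` (the block factors at
`c₋` and `c₊` are equal by translation invariance and cancel). [folklore] -/
theorem op89_flat (θ : ℝ) : op89 L (flat d θ) = flat d (L * θ) := by
  funext y μ
  simp only [op89, blockF_flat, avg15_flat, flat]
  ring

/-- `\bar\bar U₁^n = e^{iL^nθ}` in phases: the level-`n` field is flat with value `L^n θ`. [folklore] -/
theorem level_flat (θ : ℝ) (n : ℕ) : level L (flat d θ) n = flat d ((L : ℝ) ^ n * θ) := by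
  induction n with
  | zero => simp [level_zero]
  | succ n ih =>
    rw [level_succ, ih, op89_flat]
    congr 1
    ring

/-- `v_j = exp(i Σ_{l<j} (d(L−1)/2) L^l θ)` in phases. [folklore] -/
theorem vPhase_flat (θ : ℝ) (j : ℕ) (y : Site d) :
    vPhase L (flat d θ) j y = ∑ l ∈ Finset.range j, stairMean d L * ((L : ℝ) ^ l * θ) := by
  induction j generalizing y with
  | zero => simp [vPhase]
  | succ j ih => rw [vPhase, ih, level_flat, blockF_flat, Finset.sum_range_succ]

/-- The crossing phase at level `j+1` is `flatRatio d L · L^{j+1}θ` (`flatRatio = 1 + d(L−1)/(2L)`,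
`B8Ineq145.flat_log_identity`). [folklore] -/
theorem crossPhase_flat (hL : 0 < L) (θ : ℝ) (j : ℕ) (x : Site d) (μ : Fin d) :
    crossPhase L (flat d θ) j x μ = flatRatio d L * ((L : ℝ) ^ (j + 1) * θ) := by
  rw [crossPhase, level_flat, level_flat, blockF_flat]
  simp only [flat]
  rw [show (L : ℝ) ^ (j + 1) * θ = L * ((L : ℝ) ^ j * θ) by ring]
  exact flat_log_identity d L hL _

/-! ## §4  `G = U(1) ⊂ ℂ`: the printed group-valued formulas, evaluated on the flat field

B7 p. 18 lets `G` be a Lie subgroup of a unitary group; for `G = U(1)` (equivalently: a maximal torus of any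
`G`, all variables multiples of one Cartan element `X`) the bond variables are `U_b = e^{iA_b} ∈ ℂ`, the
`log` of B7 (21) is the tree's series `MatrixLog.mlog` on `𝔄 = ℂ`, and every bar of (15)/(78)/(82)/(105)/(110)
is the tree's carrier `B7BlockAvgLog.barAvg` (base value `1` here).  -/

/-- B7 (9): the contour variable `U(Γ) = U(b₁)U(b₂)…`, `U(b^{-1}) = U(b)^{-1}`, for a `ℂ`-valued bond field.
[cite: Balaban1985Averaging, (9) p. 18] -/
noncomputable def gtransport (U : Site d → Fin d → ℂ) : Site d → Word d → ℂ
  | _, [] => 1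
  | x, (μ, true) :: w => U x μ * gtransport U (x + unitVec μ) w
  | x, (μ, false) :: w => (U (x - unitVec μ) μ)⁻¹ * gtransport U (x - unitVec μ) w

/-- `U = e^{iA}` bondwise. [folklore] -/
noncomputable def expField (A : Site d → Fin d → ℝ) : Site d → Fin d → ℂ :=
  fun x μ => Complex.exp (Complex.I * A x μ)

/-- Abelian contour variables are exponentials of additive transports. [folklore] -/
theorem gtransport_expField (A : Site d → Fin d → ℝ) (x : Site d) (w : Word d) :
    gtransport (expField A) x w = Complex.exp (Complex.I * transport A x w) := by
  induction w generalizing x with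
  | nil => simp [gtransport, transport]
  | cons p w ih =>
    obtain ⟨μ, b⟩ := p
    cases b
    · simp only [gtransport, transport, ih, expField]
      rw [← Complex.exp_neg, ← Complex.exp_add]
      congr 1
      push_cast
      ring
    · simp only [gtransport, transport, ih, expField]
      rw [← Complex.exp_add]
      congr 1
      push_cast
      ring

/-- B7 (56): `R(X)Y = XYX^{-1}`. [cite: Balaban1985Averaging, (56) p. 27] -/
noncomputable def rC (g z : ℂ) : ℂ := g * z * g⁻¹

/-- `R(1) =` identity. [folklore] -/
@[simp] theorem rC_one (z : ℂ) : rC 1 z = z := by simp [rC]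

/-- B7 (15) = (42), literally, for a `ℂ`-valued field on the fine lattice and the coarse bond `c = ⟨y, y+e_μ⟩`:
`Ū_c = exp[i Σ_{x∈B(c₋)} L^{-d} (1/i) log U(Γ_{c,x})U(c)^{-1}] U(c)` (`barAvg` is exactly the bracket's
exponential). [cite: Balaban1985Averaging, (15) p. 19] -/
noncomputable def gavg15 (U : Site d → Fin d → ℂ) (y : Site d) (μ : Fin d) : ℂ :=
  barAvg (Finset.univ : Finset (Fin d → Fin L)) (fun _ => wt d L)
      (fun o => gtransport U (base L y) (gammaWord L o μ) * (gtransport U (base L y) (straightWord L μ))⁻¹)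
    * gtransport U (base L y) (straightWord L μ)

/-- B7 (105) (= (82), (110)), literally, with `R̄ = R(Ū₀(…)) = R(1)`:
`\overline{R̄_{0,y}W} = exp[i Σ_{x∈B(y)} L^{-d} (1/i) log W(Γ_{y,x})]`. [cite: Balaban1985Averaging, (105) p. 33] -/
noncomputable def gblockF (U : Site d → Fin d → ℂ) (y : Site d) : ℂ :=
  barAvg (Finset.univ : Finset (Fin d → Fin L)) (fun _ => wt d L)
    (fun o => gtransport U (base L y) (stairWord L o))

/-- B7 (89), literally, with `V₀ = 1`, `V̄₀ = 1` (so `Ṽ₁ = (V₁V₀)‾(V̄₀)^{-1} = V̄₁` and `R̄_{0,c} = R((V̄₀)_c) = R(1)`):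
`\bar\bar V_c = (\overline{R_{0,c₋}V₁})^{-1} Ṽ₁,c R̄_{0,c} \overline{R_{0,c₊}V₁}`. [cite: Balaban1985Averaging, (89) p. 31] -/
noncomputable def gop89 (U : Site d → Fin d → ℂ) : Site d → Fin d → ℂ :=
  fun y μ => (gblockF L U y)⁻¹ * (gavg15 L U y μ * (1 : ℂ)⁻¹) * rC 1 (gblockF L U (y + unitVec μ))

/-- B7 (90)/(91): `\bar\bar U₁ = \overline{R(U₀)U₁}`, `\bar\bar U₁^{j+1} = \overline{R(Ū₀^j)\bar\bar U₁^j}` with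
`U₀ = 1` (hence `Ū₀^j = 1` for all `j`). [cite: Balaban1985Averaging, (90)–(91) p. 31] -/
noncomputable def glevel (U : Site d → Fin d → ℂ) (n : ℕ) : Site d → Fin d → ℂ := (gop89 L)^[n] U

/-- [folklore] -/
theorem glevel_zero (U : Site d → Fin d → ℂ) : glevel L U 0 = U := rfl

/-- [folklore] -/
theorem glevel_succ (U : Site d → Fin d → ℂ) (n : ℕ) : glevel L U (n + 1) = gop89 L (glevel L U n) := by
  rw [glevel, Function.iterate_succ_apply']; rfl

/-- B7 (97)/(100): `v_j(x) = (\overline{R_{0,x}U₁})(\overline{R̄_{0,x}\bar\bar U₁})⋯(\overline{R̄^{j-1}_{0,x}\bar\bar U₁^{j-1}})`,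
built by `v_{j+1}(y) = v_j(y)(\overline{R̄^j_{0,y}\bar\bar U₁^j})`. [cite: Balaban1985Averaging, (97), (100) p. 32] -/
noncomputable def gv (U : Site d → Fin d → ℂ) : ℕ → Site d → ℂ
  | 0, _ => 1
  | j + 1, y => gv U j (base L y) * gblockF L (glevel L U j) y

/-- The one analytic input: for commuting variables `e^{iφ_x}` with `|φ_x| < ln 2` the exp-mean-log bar is the
exponential of the mean phase — `log e^{iφ} = iφ` is the tree's `B7BlockAvgLog.mlog_exp`. [folklore] -/
theorem barAvg_exp_phases {ι : Type*} (t : Finset ι) (c : ι → ℝ) (φ : ι → ℝ)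
    (h : ∀ o ∈ t, |φ o| < Real.log 2) :
    barAvg t c (fun o => Complex.exp (Complex.I * φ o)) = Complex.exp (Complex.I * ∑ o ∈ t, c o * φ o) := by
  rw [barAvg_eq_exp_sum]
  have hlog : ∀ o ∈ t, mlog (Complex.exp (Complex.I * φ o)) = Complex.I * φ o := by
    intro o ho
    rw [congr_fun Complex.exp_eq_exp_ℂ (Complex.I * φ o)]
    apply mlog_exp
    simpa [norm_mul, Complex.norm_I, Complex.norm_real] using h o ho
  rw [Finset.sum_congr rfl fun o ho => by rw [hlog o ho], congr_fun Complex.exp_eq_exp_ℂ]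
  congr 1
  push_cast
  rw [Finset.mul_sum]
  exact Finset.sum_congr rfl fun o _ => by rw [Complex.real_smul]; ring

/-- (105) evaluated: `\overline{R̄_{0,y}e^{iA}} = exp(i · blockF A y)` whenever all staircase phases are `< ln 2`
in size. [folklore] -/
theorem gblockF_expField (A : Site d → Fin d → ℝ) (y : Site d)
    (h : ∀ o : Fin d → Fin L, |transport A (base L y) (stairWord L o)| < Real.log 2) :
    gblockF L (expField A) y = Complex.exp (Complex.I * blockF L A y) := by
  unfold gblockF blockF
  simp only [gtransport_expField]
  rw [barAvg_exp_phases _ _ _ fun o _ => h o]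

/-- (15) evaluated: `\overline{e^{iA}}_c = exp(i · avg15 A c)` whenever all `A(Γ_{c,x}) − A(c)` are `< ln 2` in
size. [folklore] -/
theorem gavg15_expField (A : Site d → Fin d → ℝ) (y : Site d) (μ : Fin d)
    (h : ∀ o : Fin d → Fin L, |transport A (base L y) (gammaWord L o μ)
      - transport A (base L y) (straightWord L μ)| < Real.log 2) :
    gavg15 L (expField A) y μ = Complex.exp (Complex.I * avg15 L A y μ) := by
  unfold gavg15 avg15
  simp only [gtransport_expField]
  have hf : (fun o : Fin d → Fin L => Complex.exp (Complex.I * transport A (base L y) (gammaWord L o μ))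
        * (Complex.exp (Complex.I * transport A (base L y) (straightWord L μ)))⁻¹)
      = fun o => Complex.exp (Complex.I * ((transport A (base L y) (gammaWord L o μ)
        - transport A (base L y) (straightWord L μ) : ℝ) : ℂ)) := by
    funext o
    rw [← Complex.exp_neg, ← Complex.exp_add]
    congr 1
    push_cast
    ring
  rw [hf, barAvg_exp_phases _ _ _ fun o _ => h o, ← Complex.exp_add]
  congr 1
  push_cast
  ring

/-- Smallness of the staircase phases of a flat field: `|θ·Σ_μ o_μ| ≤ d(L−1)|θ|`. [folklore] -/
theorem stair_phase_small (θ : ℝ) (hθ : (d : ℝ) * ((L : ℝ) - 1) * |θ| < Real.log 2) (y : Site d)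
    (o : Fin d → Fin L) : |transport (flat d θ) (base L y) (stairWord L o)| < Real.log 2 := by
  rw [transport_flat, netCount_stairWord]
  push_cast
  have hsum : ∑ μ, ((o μ : ℕ) : ℝ) ≤ d * ((L : ℝ) - 1) := by
    calc ∑ μ, ((o μ : ℕ) : ℝ) ≤ ∑ _μ : Fin d, ((L : ℝ) - 1) := Finset.sum_le_sum fun μ _ => by
            have h1 : ((o μ : ℕ) : ℝ) + 1 ≤ L := by exact_mod_cast (o μ).isLt
            linarith
      _ = d * ((L : ℝ) - 1) := by rw [Finset.sum_const, Finset.card_univ, Fintype.card_fin, nsmul_eq_mul]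
  have h0 : 0 ≤ ∑ μ, ((o μ : ℕ) : ℝ) := by positivity
  calc |θ * ∑ μ, ((o μ : ℕ) : ℝ)| = |θ| * ∑ μ, ((o μ : ℕ) : ℝ) := by rw [abs_mul, abs_of_nonneg h0]
    _ ≤ |θ| * (d * ((L : ℝ) - 1)) := by gcongr
    _ = d * ((L : ℝ) - 1) * |θ| := by ring
    _ < Real.log 2 := hθ

/-- In (15) on the flat field every logarithm is `log 1`. [folklore] -/
theorem gamma_phase_zero (θ : ℝ) (y : Site d) (μ : Fin d) (o : Fin d → Fin L) :
    |transport (flat d θ) (base L y) (gammaWord L o μ) - transport (flat d θ) (base L y) (straightWord L μ)|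
      < Real.log 2 := by
  rw [transport_flat, transport_flat, netCount_gammaWord, netCount_straightWord, sub_self, abs_zero]
  exact Real.log_pos one_lt_two

/-- ONE STEP OF B7 ON THE FLAT `U(1)` FIELD: (89) [with (15), (105)] maps `e^{iθ}` (every fine bond) to `e^{iLθ}`
(every coarse bond), provided the staircase phases stay in the `log ∘ exp` domain (`d(L−1)|θ| < ln 2`).
[folklore] -/
theorem gop89_expField_flat (θ : ℝ) (hθ : (d : ℝ) * ((L : ℝ) - 1) * |θ| < Real.log 2) :
    gop89 L (expField (flat d θ)) = expField (flat d (L * θ)) := by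
  funext y μ
  rw [gop89, gblockF_expField L _ _ (stair_phase_small L θ hθ y),
    gblockF_expField L _ _ (stair_phase_small L θ hθ _), gavg15_expField L _ _ _ (gamma_phase_zero L θ y μ),
    blockF_flat, blockF_flat, avg15_flat, rC_one, inv_one, mul_one]
  simp only [expField, flat]
  rw [← Complex.exp_neg, ← Complex.exp_add, ← Complex.exp_add]
  congr 1
  push_cast
  ring

/-- THE TOWER: `\bar\bar U₁^n = e^{iL^nθ}` on every level-`n` bond, for the literal (89)–(91) with `U₀ = 1`,
as long as `d(L−1)L^m|θ| < ln 2` for all `m < n`. [folklore] -/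
theorem glevel_expField_flat (θ : ℝ) (n : ℕ)
    (hθ : ∀ m < n, (d : ℝ) * ((L : ℝ) - 1) * ((L : ℝ) ^ m * |θ|) < Real.log 2) :
    glevel L (expField (flat d θ)) n = expField (flat d ((L : ℝ) ^ n * θ)) := by
  induction n with
  | zero => simp [glevel_zero]
  | succ n ih =>
    rw [glevel_succ, ih fun m hm => hθ m (by omega), gop89_expField_flat]
    · congr 1
      funext x ν
      simp only [flat]
      ring
    · have h := hθ n (by omega)
      rwa [abs_mul, abs_pow, Nat.abs_cast]

/-- The block factor of the tower: `\overline{R̄^j_{0,y}\bar\bar U₁^j} = exp(i (d(L−1)/2) L^jθ)`. [folklore] -/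
theorem gblockF_glevel_flat (θ : ℝ) (j : ℕ)
    (hθ : ∀ m ≤ j, (d : ℝ) * ((L : ℝ) - 1) * ((L : ℝ) ^ m * |θ|) < Real.log 2) (y : Site d) :
    gblockF L (glevel L (expField (flat d θ)) j) y
      = Complex.exp (Complex.I * ((stairMean d L * ((L : ℝ) ^ j * θ) : ℝ) : ℂ)) := by
  have hj : (d : ℝ) * ((L : ℝ) - 1) * |(L : ℝ) ^ j * θ| < Real.log 2 := by
    have h := hθ j le_rfl
    rwa [abs_mul, abs_pow, Nat.abs_cast]
  rw [glevel_expField_flat L θ j fun m hm => hθ m hm.le, gblockF_expField L _ _ (stair_phase_small L _ hj y),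
    blockF_flat]

/-- `v_j = exp(i · vPhase)` on the tower. [folklore] -/
theorem gv_flat (θ : ℝ) (j : ℕ)
    (hθ : ∀ m < j, (d : ℝ) * ((L : ℝ) - 1) * ((L : ℝ) ^ m * |θ|) < Real.log 2) (y : Site d) :
    gv L (expField (flat d θ)) j y = Complex.exp (Complex.I * vPhase L (flat d θ) j y) := by
  induction j generalizing y with
  | zero => simp [gv, vPhase]
  | succ j ih =>
    rw [gv, ih (fun m hm => hθ m (by omega)) (base L y),
      gblockF_glevel_flat L θ j (fun m hm => hθ m (by omega)) y, vPhase, level_flat, blockF_flat,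
      ← Complex.exp_add]
    congr 1
    push_cast
    ring

/-- The value of `Ũ′^{j+1}_b = \overline{R̄^j_{0,b₋}\bar\bar U₁^j}·(\bar\bar U₁^{j+1})_b` (B8 p. 81 / (1.31) line 2;
`B8Ineq145.LevelData.crossing`) on the bond `b = ⟨x, x + e_μ⟩` of the literal tower. [folklore] -/
noncomputable def gcross (θ : ℝ) (j : ℕ) (x : Site d) (μ : Fin d) : ℂ :=
  gblockF L (glevel L (expField (flat d θ)) j) x * glevel L (expField (flat d θ)) (j + 1) x μ

/-- `Ũ′^{j+1}_b = exp(i · flatRatio d L · L^{j+1}θ)` on the tower. [folklore] -/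
theorem gcross_eq (hL : 0 < L) (θ : ℝ) (j : ℕ)
    (hθ : ∀ m ≤ j, (d : ℝ) * ((L : ℝ) - 1) * ((L : ℝ) ^ m * |θ|) < Real.log 2) (x : Site d) (μ : Fin d) :
    gcross L θ j x μ = Complex.exp (Complex.I * ((flatRatio d L * ((L : ℝ) ^ (j + 1) * θ) : ℝ) : ℂ)) := by
  rw [gcross, gblockF_glevel_flat L θ j hθ x, glevel_expField_flat L θ (j + 1) fun m hm => hθ m (by omega)]
  simp only [expField, flat]
  rw [← Complex.exp_add, ← crossPhase_flat L hL θ j x μ, crossPhase, level_flat, level_flat, blockF_flat]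
  simp only [flat]
  push_cast
  ring

/-- `|Ũ′^{j+1}_b − 1| = 2|sin(flatRatio d L · L^{j+1}θ / 2)|`. [folklore] -/
theorem norm_gcross_sub_one (hL : 0 < L) (θ : ℝ) (j : ℕ)
    (hθ : ∀ m ≤ j, (d : ℝ) * ((L : ℝ) - 1) * ((L : ℝ) ^ m * |θ|) < Real.log 2) (x : Site d) (μ : Fin d) :
    ‖gcross L θ j x μ - 1‖ = 2 * |Real.sin (flatRatio d L * ((L : ℝ) ^ (j + 1) * θ) / 2)| := by
  rw [gcross_eq L hL θ j hθ x μ, Complex.norm_exp_I_mul_ofReal_sub_one, Real.norm_eq_abs, abs_mul,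
    abs_two]

/-- **The printed inequality (1.145) fails on the literal B7 tower.**  `d = 4`, `L = 3`, top level `k = j+1`,
flat `U(1)` field with `L^kηa = (27/28)α₂` (so (1.140) `L^kη|A| < α₂` holds strictly and all derivative terms
vanish), `0 < α₂ ≤ 1/4` (keeps every logarithm of (15)/(105) inside `|·| < ln 2`): on any bond `b` crossing
into `Λ_k`, `|Ũ′^k_b − 1| = 2 sin((9/8)α₂) > 2α₂` (`B8Ineq145.flat_witness_exceeds`). [folklore] -/
theorem flat_tower_violates_145 (j : ℕ) (α₂ θ : ℝ) (h0 : 0 < α₂) (h1 : α₂ ≤ 1 / 4)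
    (hθ : (3 : ℝ) ^ (j + 1) * θ = 27 / 28 * α₂) (x : Site 4) (μ : Fin 4) :
    2 * α₂ < ‖gcross 3 θ j x μ - 1‖ := by
  have hθpos : 0 < θ := by
    have h3 : (0 : ℝ) < (3 : ℝ) ^ (j + 1) := by positivity
    nlinarith
  have hsmall : ∀ m ≤ j, ((4 : ℕ) : ℝ) * (((3 : ℕ) : ℝ) - 1) * (((3 : ℕ) : ℝ) ^ m * |θ|) < Real.log 2 := by
    intro m hm
    have hpow : (3 : ℝ) ^ m * θ ≤ (3 : ℝ) ^ j * θ := by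
      have : (3 : ℝ) ^ m ≤ (3 : ℝ) ^ j := pow_le_pow_right₀ (by norm_num) hm
      nlinarith
    have hj : (3 : ℝ) ^ j * θ = 9 / 28 * α₂ := by
      have : (3 : ℝ) ^ (j + 1) * θ = 3 * ((3 : ℝ) ^ j * θ) := by ring
      linarith
    rw [abs_of_pos hθpos]
    push_cast
    have := Real.log_two_gt_d9
    nlinarith
  have hnorm := norm_gcross_sub_one 3 (by norm_num) θ j hsmall x μ
  have hcast : ((3 : ℕ) : ℝ) ^ (j + 1) * θ = 27 / 28 * α₂ := by push_cast; exact hθ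
  rw [hcast] at hnorm
  rw [hnorm]
  calc 2 * α₂ < 2 * Real.sin (flatRatio 4 3 * (27 / 28 * α₂) / 2) := flat_witness_exceeds α₂ h0 (by linarith)
    _ ≤ 2 * |Real.sin (flatRatio 4 3 * (27 / 28 * α₂) / 2)| := by gcongr; exact le_abs_self _

/-! ## §5  The tower as an instance of `B8Ineq145.LevelData` (`G = ℂˣ`): the printed (1.30) evaluated

`B8Ineq145.LevelData` carries the displayed laws B8 (1.30), B7 (97), (84)+(99) (levels `j+1` and `j`), (100) as
fields over an abstract group; here they are instantiated by the tower of §4 on the bond `b = ⟨x₀, x₀ + e_μ⟩`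
crossing into `Λ_{j+1}` (`b₋ = x₀ ∈ Λ_j`: (1.29) at level `j`, i.e. `u(b₋) = v_j(b₋)^{-1}`; `b₊ ∈ Λ_{j+1}`:
(1.29) at level `j+1`, i.e. `u(b₊) = v_{j+1}(b₊)^{-1}` — B8 p. 81), and `LevelData.crossing` (gen 9, kernel)
turns the left-hand side of (1.30) into `F(b₋)·(Ū₁^{j+1})_b = gcross`. -/

/-- `e^{iφ}` as a unit of `ℂ`. [folklore] -/
noncomputable def expU (φ : ℝ) : ℂˣ := Units.mk0 (Complex.exp (Complex.I * φ)) (Complex.exp_ne_zero _)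

/-- [folklore] -/
@[simp] theorem coe_expU (φ : ℝ) : ((expU φ : ℂˣ) : ℂ) = Complex.exp (Complex.I * φ) := rfl

/-- [folklore] -/
theorem expU_add (a b : ℝ) : expU (a + b) = expU a * expU b := by
  apply Units.ext
  simp only [Units.val_mul, coe_expU]
  rw [← Complex.exp_add]
  congr 1
  push_cast
  ring

/-- The level-`(j+1)` data of B8 Sect. B/G for the flat tower, on sites of the `(j+1)`-lattice and its positive
bonds `(x, μ) = ⟨x, x + e_μ⟩`: `W = (Ū₁^{j+1})_b = e^{iL^{j+1}θ}` (tower value, `flatLevelData_dictionary`),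
`r = Ū₀^{j+1} = 1`, `v = v_{j+1}`, `vPrev = v_j`, `F = \overline{R̄^j_{0,·}\bar\bar U₁^j}` (B7 (97), (100), (105)),
`u` = the gauge transformation with (1.29) imposed at level `j` at the site `x₀` and at level `j+1` elsewhere
(B7 (84)/(87): `u = v^{-1}` where `R̄₀u = 1`), `Ut = Ũ₁^{j+1}` by (97), `Uu` = the left-hand side of B8 (1.30).
[cite: Balaban1985RegularSpaces, (1.29)–(1.30) p. 81] -/
noncomputable def flatLevelData (d L : ℕ) (θ : ℝ) (j : ℕ) (x₀ : Site d) :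
    LevelData (Site d) (Site d × Fin d) ℂˣ :=
  let W : Site d × Fin d → ℂˣ := fun _ => expU ((L : ℝ) ^ (j + 1) * θ)
  let F : Site d → ℂˣ := fun _ => expU (stairMean d L * ((L : ℝ) ^ j * θ))
  let v : Site d → ℂˣ := fun y => expU (vPhase L (flat d θ) (j + 1) y)
  let vPrev : Site d → ℂˣ := fun y => expU (vPhase L (flat d θ) j (base L y))
  let u : Site d → ℂˣ := fun y => if y = x₀ then (vPrev y)⁻¹ else (v y)⁻¹
  let Ut : Site d × Fin d → ℂˣ := fun b => v b.1 * W b * rOp 1 (v (b.1 + unitVec b.2))⁻¹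
  { src := fun b => b.1
    tgt := fun b => b.1 + unitVec b.2
    r := fun _ => 1
    W := W
    Ut := Ut
    Uu := fun b => u b.1 * Ut b * rOp 1 (u (b.1 + unitVec b.2))⁻¹
    u := u
    Ru := fun y => u y * v y
    v := v
    RuPrev := fun y => u y * vPrev y
    vPrev := vPrev
    F := F
    h130 := fun _ => rfl
    h97 := fun _ => rfl
    h84 := fun _ => rfl
    h84prev := fun _ => rfl
    h100 := fun y => by
      show expU _ = expU _ * expU _
      rw [← expU_add, vPhase, level_flat, blockF_flat] }

/-- DICTIONARY CHECK: the fields of `flatLevelData` are the values of the literal tower of §4 —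
`W = \bar\bar U₁^{j+1}` (B7 (91)), `F = \overline{R̄^j_{0,·}\bar\bar U₁^j}` (B7 (105)), `v = v_{j+1}`, `vPrev = v_j`
(B7 (97)/(100)). [folklore] -/
theorem flatLevelData_dictionary (θ : ℝ) (j : ℕ)
    (hθ : ∀ m ≤ j, (d : ℝ) * ((L : ℝ) - 1) * ((L : ℝ) ^ m * |θ|) < Real.log 2) (x₀ y : Site d) (μ : Fin d) :
    (((flatLevelData d L θ j x₀).W (y, μ) : ℂˣ) : ℂ) = glevel L (expField (flat d θ)) (j + 1) y μ ∧
    (((flatLevelData d L θ j x₀).F y : ℂˣ) : ℂ) = gblockF L (glevel L (expField (flat d θ)) j) y ∧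
    (((flatLevelData d L θ j x₀).v y : ℂˣ) : ℂ) = gv L (expField (flat d θ)) (j + 1) y ∧
    (((flatLevelData d L θ j x₀).vPrev y : ℂˣ) : ℂ) = gv L (expField (flat d θ)) j (base L y) := by
  refine ⟨?_, ?_, ?_, ?_⟩
  · rw [glevel_expField_flat L θ (j + 1) fun m hm => hθ m (by omega)]
    simp only [flatLevelData, coe_expU, expField, flat]
  · rw [gblockF_glevel_flat L θ j hθ y]
    simp only [flatLevelData, coe_expU]
  · rw [gv_flat L θ (j + 1) (fun m hm => hθ m (by omega)) y]
    simp only [flatLevelData, coe_expU]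
  · rw [gv_flat L θ j (fun m hm => hθ m (by omega)) (base L y)]
    simp only [flatLevelData, coe_expU]

/-- THE PRINTED (1.30) EVALUATED: with (1.29) at `b₋ = x₀` (level `j`) and at `b₊ = x₀ + e_μ` (level `j+1`), the
left-hand side `u(b₋)(Ũ₁^{j+1})_b R̄_{0,b} u^{-1}(b₊)` of (1.30) is `F(b₋)(Ū₁^{j+1})_b` (`LevelData.crossing`,
i.e. B8 p. 81 / (1.31) line 2) `= gcross = exp(i·flatRatio d L·L^{j+1}θ)`. [folklore] -/
theorem flatLevelData_Uu (hL : 0 < L) (θ : ℝ) (j : ℕ)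
    (hθ : ∀ m ≤ j, (d : ℝ) * ((L : ℝ) - 1) * ((L : ℝ) ^ m * |θ|) < Real.log 2) (x₀ : Site d) (μ : Fin d) :
    (((flatLevelData d L θ j x₀).Uu (x₀, μ) : ℂˣ) : ℂ) = gcross L θ j x₀ μ := by
  have hne : x₀ + unitVec μ ≠ x₀ := by
    intro h
    have h' := congr_fun h μ
    simp [unitVec] at h'
  have hs : (flatLevelData d L θ j x₀).RuPrev ((flatLevelData d L θ j x₀).src (x₀, μ)) = 1 := by
    simp [flatLevelData]
  have ht : (flatLevelData d L θ j x₀).Ru ((flatLevelData d L θ j x₀).tgt (x₀, μ)) = 1 := by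
    simp [flatLevelData, hne]
  rw [(flatLevelData d L θ j x₀).crossing hs ht, gcross_eq L hL θ j hθ x₀ μ]
  simp only [flatLevelData, Units.val_mul, coe_expU]
  rw [← Complex.exp_add]
  congr 1
  rw [← crossPhase_flat L hL θ j x₀ μ, crossPhase, level_flat, level_flat, blockF_flat]
  simp only [flat]
  push_cast
  ring

/-- **(1.145) versus (1.30) on the tower**, `d = 4`, `L = 3`, `L^{j+1}ηa = (27/28)α₂`, `0 < α₂ ≤ 1/4`:
the left-hand side of (1.30) on the crossing bond `⟨x₀, x₀ + e_μ⟩` lies at distance `2 sin((9/8)α₂) > 2α₂`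
from `1` — the printed bound `< 2α₂` of (1.145) fails there (census C-B8-30; the EQUALITY of (1.145) fails by
`B8Ineq145.LevelData.eq145_iff`, the block factor being `e^{i·4·(27/28)α₂/3… } ≠ 1`). [folklore] -/
theorem printed_145_fails_on_tower (j : ℕ) (α₂ θ : ℝ) (h0 : 0 < α₂) (h1 : α₂ ≤ 1 / 4)
    (hθ : (3 : ℝ) ^ (j + 1) * θ = 27 / 28 * α₂) (x₀ : Site 4) (μ : Fin 4) :
    2 * α₂ < ‖(((flatLevelData 4 3 θ j x₀).Uu (x₀, μ) : ℂˣ) : ℂ) - 1‖ := by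
  have hθpos : 0 < θ := by
    have h3 : (0 : ℝ) < (3 : ℝ) ^ (j + 1) := by positivity
    nlinarith
  have hsmall : ∀ m ≤ j, ((4 : ℕ) : ℝ) * (((3 : ℕ) : ℝ) - 1) * (((3 : ℕ) : ℝ) ^ m * |θ|) < Real.log 2 := by
    intro m hm
    have hpow : (3 : ℝ) ^ m * θ ≤ (3 : ℝ) ^ j * θ := by
      have : (3 : ℝ) ^ m ≤ (3 : ℝ) ^ j := pow_le_pow_right₀ (by norm_num) hm
      nlinarith
    have hj : (3 : ℝ) ^ j * θ = 9 / 28 * α₂ := by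
      have : (3 : ℝ) ^ (j + 1) * θ = 3 * ((3 : ℝ) ^ j * θ) := by ring
      linarith
    rw [abs_of_pos hθpos]
    push_cast
    have := Real.log_two_gt_d9
    nlinarith
  rw [flatLevelData_Uu 3 (by norm_num) θ j hsmall x₀ μ]
  exact flat_tower_violates_145 j α₂ θ h0 h1 hθ x₀ μ

end Literature.MathematicalPhysics.QuantumFieldTheory.Balaban1983to89.B8Ineq145Flat
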